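/-
Copyright (c) 2026 the pub-hodgecm-mathlib formalisation cell (harness21).  Prover seat hodgecm-mathlib-K2Liu-p02 (g5), Track B «K2-LIT» ∕ hLiu418
#184♮, Road I v3, organ U2f (LEAD F0P6-plan (g12) «M-156d» (3b), 07:59:57Z (i)).  2026-09-04.
-/
import Summits.HodgeConjecture.HodgeConjecture.Theorems.K2LiuDoubledWeilRepFinHalf   -- ★ p858628: `ω^𝔻_f`, `omega_sD_tmul_eq`, smoothness
import Literature.NumberTheory.K2Lit.DoubledTensorEmbedding                         -- ★ `tensorEmb : U(𝔻)(𝔸) →* U(𝔻 ⊗ V′)(𝔸)`, `continuous_tensorEmb`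
import Literature.NumberTheory.K2Lit.SiegelStandardSections                         -- ★ `IwasawaDatum` (`isCompact_K`)
import Mathlib.RingTheory.TensorProduct.Finite
import Mathlib.Topology.LocallyConstant.Basic
import HarnessLib

/-!
# K2_Liu road (hLiu418 = stmt-HodgeConjecture-24832), Road I v3 organ U2f: THE RIGIDITY DOMAIN `𝒮_f ⊗ V_∞` SATISFIES #42F′'s `_hΦ`
# (finite-dimensional `tensorEmb(𝒦.K)`-orbit span under `ω ∘ s^B`)

Cell `pub/hodgecm-mathlib` (D-0151), Track B, build stream 29; binder sheet `K2/K2E5-plan/g6/SIGS-RoadI-v3.md` §2 U2f («every `x ∈ 𝒮_f ⊗ V_∞` (finite sum of pure tensors, `V_∞`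
K_∞-stable finite-dimensional, each `x_w` fixed by an open compact) has finite-dimensional `𝒦.K`-orbit span under `adelicMpCont.omega … (doubledWeilRep …)`»; M-156d (3b)).  This is the
DISCHARGE of the binder `_hΦ` of socket #42F′ `sig_K2LiuFirstTermIdentityOnGenerators` for the data U5 feeds it (`x = v_∞ ⊗ Φ_f`), over ANY `χ_b`-normalised doubled Weil representation
`s^B` of the big datum `(e′, dV, tensorFrame dW eW dV′)` (★ `IsDoubledWeilRep`; the concrete ★ `doubledWeilRep` via ★ `isDoubledWeilRep_doubledWeilRep`) and ANY Iwasawa datum `𝒦` of the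
small group `H = U(𝔻)` (only the compactness ★ `IwasawaDatum.isCompact_K` is used — NOT `IsStd`).  The finite half is FREE: by ★ p858628 (`K2LiuDoubledWeilRepFinHalf`) every `Φ_f` is fixed by
a principal congruence level of `H_big(𝔸_f)`, so its orbit under the compact `finPart(tensorEmb(𝒦.K))` is FINITE (a locally constant map on a compact space has finite range); the ONE
input is the archimedean stability of `V_∞`:

* §1 `finiteDimensional_span_orbit_of_le` — the bytes of `_hΦ` for every `Φ` in a finite-dimensional `tensorEmb(𝒦.K)`-stable subspace `D` (pure linear algebra);
* §2 `isLocallyConstant_finRepMp_sD_apply` ∕ **`finite_range_finRepMp_finPart_tensorEmb`** — `c ↦ ω^B_f(c) Φ_f` is locally constant on `H_big(𝔸_f)`, hence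
  `{ω^B_f(finPart(tensorEmb k)) Φ_f : k ∈ 𝒦.K}` is FINITE;
* §3 **`finiteDimensional_span_orbit_of_mem_span_tmul`** (U2f ⇒): for a finite-dimensional `V ≤ 𝓢((L⁺ ⊗ ℝ)^{n′+n′})` with
  `hV : ∀ k ∈ 𝒦.K, ∀ a ∈ V, ∃ a′ ∈ V, ∀ Φ_f, ω(s^B(g_∞, 1)) E(a ⊗ Φ_f) = E(a′ ⊗ Φ_f)` (`g = tensorEmb k`, `g_∞ = archPart g`; for the hol cut `V = ℂ·v` this is the scalar K-type of `v`, read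
  through ★ `K2LiuDoubledWeilRepArchPinned.omega_sD_archToAdelic_tmul`) and every `Φ ∈ span{E(a ⊗ Φ_f) : a ∈ V}`, the span of `{ω(s^B(tensorEmb k)) Φ : k ∈ 𝒦.K}` is finite-dimensional —
  literally #42F′'s `_hΦ` over `s^B`.  Proof: `ω(s^B g) E(a ⊗ Φ_f) = ω(s^B(g_∞,1)) E(a ⊗ ω^B_f(g_f) Φ_f)` (★ `omega_sD_tmul_eq`) `= E(a′ ⊗ ω^B_f(g_f) Φ_f) ∈ E(V ⊗ F)`, `F` the span of the finite
  set of §2; `E(V ⊗ F)` is finite-dimensional; §1-type span induction over the generators.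

No definition, no instance, no named fact, no `sorry`; axioms ⊆ {propext, Classical.choice, Quot.sound}.  HONEST LABEL: HC_CM is proved only modulo the 7 printed citations
(2 remaining named inputs: hLiu418 = stmt-HodgeConjecture-24832, h413 = stmt-HodgeConjecture-24833) until rung 0 closes; `--supports stmt-HodgeConjecture-24832` helper, count-neutral.
References: [HarrisKudlaSweet1996] M. Harris, S. Kudla, W. J. Sweet, J. AMS 9 (1996), §1 (1.15)–(1.17) (`K`-finite Siegel–Weil sections); [Weil1964] A. Weil, Acta Math. 111 (1964),
Chap. III n° 37–39; [GelbartRogawski1991] S. Gelbart, J. Rogawski, Invent. Math. 105 (1991), §3.1 p. 454 (smooth vectors); [BorelJacquet1979] A. Borel, H. Jacquet, PSPM 33.1 (1979),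
§4.1; [Kudla1994] S. Kudla, Israel J. Math. 87 (1994), §2; [Tan1999] V. Tan, §1 p. 166 (`K`-finite standard sections).
-/

set_option autoImplicit false
set_option linter.dupNamespace false
set_option Elab.async false

noncomputable section

open scoped Matrix TensorProduct SchwartzMap Classical
open NumberField NumberField.mixedEmbedding IsDedekindDomain

namespace Summit.HodgeConjecture.HodgeConjecture.Cruxes.HLiu418.K2LiuRigidityDomainKFinite

open Literature.NumberTheory.Automorphic Literature.NumberTheory.Automorphic.UnitaryGroup
open Literature.NumberTheory.GaloisRepresentations
open Literature.NumberTheory.GelbartRogawski1991 Literature.NumberTheory.GelbartRogawski1991.UnitaryDualPair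
open Literature.NumberTheory.GelbartRogawski1991.GRConstruction
open Literature.NumberTheory.Weil1964
open Literature.NumberTheory.K2Lit.SiegelDoubled
open Summit.HodgeConjecture.HodgeConjecture.Cruxes.HLiu418.K2LiuDoubledWeilRepFinHalf

variable (L : Type) [Field L] [NumberField L] [IsCMField L]
variable {N M n : ℕ} (e : Fin N × Fin M ≃ Fin n)
  (dV : Fin N → L) (hdV : ∀ i, IsCMField.complexConj L (dV i) = dV i) (hdV0 : ∀ i, dV i ≠ 0)
  (dW : Fin M → L) (hdW : ∀ i, IsCMField.complexConj L (dW i) = dW i) (hdW0 : ∀ i, dW i ≠ 0)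
variable {M₂ M' n' : ℕ} (eW : Fin M × Fin M₂ ≃ Fin M') (e' : Fin N × Fin M' ≃ Fin n')
  (dV' : Fin M₂ → L) (hdV' : ∀ k, IsCMField.complexConj L (dV' k) = dV' k) (hdV'0 : ∀ k, dV' k ≠ 0)
  (𝒦 : IwasawaDatum L e dV hdV dW hdW) {χb : HeckeCharacter L}
  {sB : HA L e' dV hdV (tensorFrame L dW eW dV') (tensorFrame_real L dW hdW eW dV' hdV') →*
    MpD L e' dV hdV (tensorFrame L dW eW dV') (tensorFrame_real L dW hdW eW dV' hdV')}

/-! ## §1 Stable finite-dimensional subspaces -/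

/-- **`_hΦ` inside a stable finite-dimensional subspace** (pure linear algebra): if `D` is a finite-dimensional subspace of `𝒮(𝔸^{n′+n′})` stable under `ω(s^B(tensorEmb k))` for all
`k ∈ 𝒦.K`, then every `Φ ∈ D` has finite-dimensional `tensorEmb(𝒦.K)`-orbit span (the span lies in `D`). [cite: HarrisKudlaSweet1996, §1 (1.15)–(1.17)] [cite: Tan1999, §1 p. 166] -/
theorem finiteDimensional_span_orbit_of_le (D : Submodule ℂ (piSchwartzBruhat (Fp L) (Fin (n' + n')))) [FiniteDimensional ℂ D]
    (hD : ∀ k ∈ 𝒦.K, ∀ Ψ ∈ D,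
      adelicMpCont.omega (Fp L) (Fin (n' + n')) (gramDA L e' dV hdV (tensorFrame L dW eW dV') (tensorFrame_real L dW hdW eW dV' hdV'))
        (sB (tensorEmb L e dV hdV dW hdW eW e' dV' hdV' k)) Ψ ∈ D)
    {Φ : piSchwartzBruhat (Fp L) (Fin (n' + n'))} (hΦ : Φ ∈ D) :
    FiniteDimensional ℂ (Submodule.span ℂ (Set.range fun k : 𝒦.K =>
      adelicMpCont.omega (Fp L) (Fin (n' + n')) (gramDA L e' dV hdV (tensorFrame L dW eW dV') (tensorFrame_real L dW hdW eW dV' hdV'))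
        (sB (tensorEmb L e dV hdV dW hdW eW e' dV' hdV' (k : HA L e dV hdV dW hdW))) Φ)) :=
  Submodule.finiteDimensional_of_le (Submodule.span_le.2 (by
    rintro _ ⟨k, rfl⟩
    exact hD k k.2 Φ hΦ))

/-! ## §2 The finite orbit of a finite Schwartz–Bruhat vector under a compact set -/

set_option maxHeartbeats 1000000 in -- the big datum's carrier telescope
/-- **`c ↦ ω^B_f(c) Φ_f` is LOCALLY CONSTANT on `H_big(𝔸_f)`**: `Φ_f` is fixed by a principal congruence level `K_f(𝔪)` (★ `exists_finCongruenceLevel_forall_finRepMp_sD_apply_eq_self`),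
so the orbit map is constant on every coset `c₀ K_f(𝔪)` (open, ★ `isOpen_finCongruenceLevel`). [cite: GelbartRogawski1991, §3.1 p. 454] [cite: Weil1964, Chap. III n° 37–39 pp. 187–190] -/
theorem isLocallyConstant_finRepMp_sD_apply
    (hsB : IsDoubledWeilRep L e' dV hdV hdV0 (tensorFrame L dW eW dV') (tensorFrame_real L dW hdW eW dV' hdV')
      (tensorFrame_ne_zero L dW eW dV' hdW0 hdV'0) χb sB)
    (f : FinSB (Fp L) (Fin (n' + n'))) :
    IsLocallyConstant fun c : UnitaryGroup.finAdelic (Fp L) L (IsCMField.complexConj L) (n' + n')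
        (hermD L e' dV hdV (tensorFrame L dW eW dV') (tensorFrame_real L dW hdW eW dV' hdV')) =>
      finRepMp (DoubledWeilUniqueness.isUnit_gramDA L e' dV hdV hdV0 (tensorFrame L dW eW dV') (tensorFrame_real L dW hdW eW dV' hdV')
          (tensorFrame_ne_zero L dW eW dV' hdW0 hdV'0))
        (sB.comp (UnitaryGroup.finAdelicToAdelic (Fp L) L (IsCMField.complexConj L) (n' + n')
          (hermD L e' dV hdV (tensorFrame L dW eW dV') (tensorFrame_real L dW hdW eW dV' hdV'))))
        (proj_sD_finAdelicToAdelic_apply_archVec L e' dV hdV hdV0 (tensorFrame L dW eW dV') (tensorFrame_real L dW hdW eW dV' hdV')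
          (tensorFrame_ne_zero L dW eW dV' hdW0 hdV'0) hsB) c f := by
  -- a principal congruence level fixing `f`
  have hex := exists_finCongruenceLevel_forall_finRepMp_sD_apply_eq_self L e' dV hdV hdV0 (tensorFrame L dW eW dV')
    (tensorFrame_real L dW hdW eW dV' hdV') (tensorFrame_ne_zero L dW eW dV' hdW0 hdV'0) hsB f
  obtain ⟨𝔪, h𝔪, hfix⟩ := hex
  refine (IsLocallyConstant.iff_exists_open _).2 fun c₀ => ⟨(fun c => c₀⁻¹ * c) ⁻¹'
    (UnitaryGroup.finCongruenceLevel (Fp L) L (IsCMField.complexConj L) (n' + n')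
      (hermD L e' dV hdV (tensorFrame L dW eW dV') (tensorFrame_real L dW hdW eW dV' hdV')) 𝔪 : Set _),
    (UnitaryGroup.isOpen_finCongruenceLevel (Fp L) L (IsCMField.complexConj L) (n' + n') _ h𝔪).preimage (continuous_const.mul continuous_id),
    ?_, fun c hc => ?_⟩
  · -- `c₀ ∈ c₀ K_f(𝔪)`
    simp only [Set.mem_preimage, inv_mul_cancel, SetLike.mem_coe]
    exact Subgroup.one_mem _
  · -- on the coset the orbit map is constant: `ω_f(c₀ (c₀⁻¹ c)) f = ω_f(c₀) (ω_f(c₀⁻¹ c) f) = ω_f(c₀) f` (term mode: `rw [map_mul]` is too slow here)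
    have hc' : c₀⁻¹ * c ∈ UnitaryGroup.finCongruenceLevel (Fp L) L (IsCMField.complexConj L) (n' + n')
        (hermD L e' dV hdV (tensorFrame L dW eW dV') (tensorFrame_real L dW hdW eW dV' hdV')) 𝔪 := hc
    have hmul := congrArg (fun T => T f) (map_mul
      (finRepMp (DoubledWeilUniqueness.isUnit_gramDA L e' dV hdV hdV0 (tensorFrame L dW eW dV') (tensorFrame_real L dW hdW eW dV' hdV')
          (tensorFrame_ne_zero L dW eW dV' hdW0 hdV'0))
        (sB.comp (UnitaryGroup.finAdelicToAdelic (Fp L) L (IsCMField.complexConj L) (n' + n')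
          (hermD L e' dV hdV (tensorFrame L dW eW dV') (tensorFrame_real L dW hdW eW dV' hdV'))))
        (proj_sD_finAdelicToAdelic_apply_archVec L e' dV hdV hdV0 (tensorFrame L dW eW dV') (tensorFrame_real L dW hdW eW dV' hdV')
          (tensorFrame_ne_zero L dW eW dV' hdW0 hdV'0) hsB)) c₀ (c₀⁻¹ * c))
    have hcc : c₀ * (c₀⁻¹ * c) = c := mul_inv_cancel_left c₀ c
    exact ((congrArg (fun x => finRepMp (DoubledWeilUniqueness.isUnit_gramDA L e' dV hdV hdV0 (tensorFrame L dW eW dV')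
          (tensorFrame_real L dW hdW eW dV' hdV') (tensorFrame_ne_zero L dW eW dV' hdW0 hdV'0))
        (sB.comp (UnitaryGroup.finAdelicToAdelic (Fp L) L (IsCMField.complexConj L) (n' + n')
          (hermD L e' dV hdV (tensorFrame L dW eW dV') (tensorFrame_real L dW hdW eW dV' hdV'))))
        (proj_sD_finAdelicToAdelic_apply_archVec L e' dV hdV hdV0 (tensorFrame L dW eW dV') (tensorFrame_real L dW hdW eW dV' hdV')
          (tensorFrame_ne_zero L dW eW dV' hdW0 hdV'0) hsB) x f) hcc).symm.trans hmul).trans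
      ((Module.End.mul_apply _ _ _).trans (congrArg _ (hfix _ hc')))

/-- **THE FINITE-PART ORBIT OF `Φ_f` UNDER `tensorEmb(𝒦.K)` IS FINITE**: `{ω^B_f(finPart(tensorEmb k)) Φ_f : k ∈ 𝒦.K}` is a finite set — `𝒦.K` is compact (★ `IwasawaDatum.isCompact_K`),
`k ↦ finPart(tensorEmb k)` is continuous (★ `continuous_tensorEmb`, ★ `continuous_finPart`), and a locally constant map on a compact space has finite range.  No `IsStd` hypothesis.
[cite: HarrisKudlaSweet1996, §1 (1.15)–(1.17)] [cite: BorelJacquet1979, §4.1] [cite: GelbartRogawski1991, §3.1 p. 454] -/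
theorem finite_range_finRepMp_finPart_tensorEmb
    (hsB : IsDoubledWeilRep L e' dV hdV hdV0 (tensorFrame L dW eW dV') (tensorFrame_real L dW hdW eW dV' hdV')
      (tensorFrame_ne_zero L dW eW dV' hdW0 hdV'0) χb sB)
    (f : FinSB (Fp L) (Fin (n' + n'))) :
    (Set.range fun k : 𝒦.K =>
      finRepMp (DoubledWeilUniqueness.isUnit_gramDA L e' dV hdV hdV0 (tensorFrame L dW eW dV') (tensorFrame_real L dW hdW eW dV' hdV')
          (tensorFrame_ne_zero L dW eW dV' hdW0 hdV'0))
        (sB.comp (UnitaryGroup.finAdelicToAdelic (Fp L) L (IsCMField.complexConj L) (n' + n')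
          (hermD L e' dV hdV (tensorFrame L dW eW dV') (tensorFrame_real L dW hdW eW dV' hdV'))))
        (proj_sD_finAdelicToAdelic_apply_archVec L e' dV hdV hdV0 (tensorFrame L dW eW dV') (tensorFrame_real L dW hdW eW dV' hdV')
          (tensorFrame_ne_zero L dW eW dV' hdW0 hdV'0) hsB)
        (UnitaryGroup.finPart (Fp L) L (IsCMField.complexConj L) (n' + n')
          (hermD L e' dV hdV (tensorFrame L dW eW dV') (tensorFrame_real L dW hdW eW dV' hdV'))
          (tensorEmb L e dV hdV dW hdW eW e' dV' hdV' (k : HA L e dV hdV dW hdW))) f).Finite := by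
  haveI : CompactSpace 𝒦.K := isCompact_iff_compactSpace.mp 𝒦.isCompact_K
  have hg : Continuous fun k : 𝒦.K => UnitaryGroup.finPart (Fp L) L (IsCMField.complexConj L) (n' + n')
      (hermD L e' dV hdV (tensorFrame L dW eW dV') (tensorFrame_real L dW hdW eW dV' hdV'))
      (tensorEmb L e dV hdV dW hdW eW e' dV' hdV' (k : HA L e dV hdV dW hdW)) :=
    (UnitaryGroup.continuous_finPart (Fp L) L (IsCMField.complexConj L) (n' + n') _).comp
      ((continuous_tensorEmb L e dV hdV dW hdW eW e' dV' hdV').comp continuous_subtype_val)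
  exact ((isLocallyConstant_finRepMp_sD_apply L dV hdV hdV0 dW hdW hdW0 eW e' dV' hdV' hdV'0 hsB f).comp_continuous hg).range_finite

/-! ## §3 U2f (⇒): the rigidity domain `V_∞ ⊗ 𝒮_f` satisfies `_hΦ` -/

set_option maxHeartbeats 2000000 in -- the big datum's carrier telescope
/-- **U2f (⇒ direction) — THE RIGIDITY DOMAIN SATISFIES #42F′'s `_hΦ`.**  Let `V ≤ 𝓢((L⁺ ⊗ ℝ)^{n′+n′})` be finite-dimensional and ARCHIMEDEAN-STABLE along `tensorEmb(𝒦.K)`: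
for `k ∈ 𝒦.K` and `a ∈ V` there is `a′ ∈ V` with `ω(s^B(g_∞, 1)) E(a ⊗ Φ_f) = E(a′ ⊗ Φ_f)` for all `Φ_f` (`g = tensorEmb k`; e.g. `V = ℂ·v` for a vector `v` of scalar K-type).  Then every
`Φ` in the span of the pure tensors `E(a ⊗ Φ_f)`, `a ∈ V`, `Φ_f ∈ 𝒮((𝔸_f)^{n′+n′})` arbitrary, has FINITE-DIMENSIONAL `tensorEmb(𝒦.K)`-orbit span under `ω ∘ s^B` — the binder `_hΦ` of
`sig_K2LiuFirstTermIdentityOnGenerators` over `s^B` (take `hsB := isDoubledWeilRep_doubledWeilRep …` for the concrete `doubledWeilRep`).  The finite factors need NO hypothesis (§2).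
[cite: HarrisKudlaSweet1996, §1 (1.15)–(1.17)] [cite: Tan1999, §1 p. 166] [cite: BorelJacquet1979, §4.1] [cite: Weil1964, Chap. III n° 37–39 pp. 187–190] [cite: GelbartRogawski1991, §3.1 p. 454] -/
theorem finiteDimensional_span_orbit_of_mem_span_tmul
    (hsB : IsDoubledWeilRep L e' dV hdV hdV0 (tensorFrame L dW eW dV') (tensorFrame_real L dW hdW eW dV' hdV')
      (tensorFrame_ne_zero L dW eW dV' hdW0 hdV'0) χb sB)
    (V : Submodule ℂ 𝓢(((Fin (n' + n')) → mixedSpace (Fp L)), ℂ)) [FiniteDimensional ℂ V]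
    (hV : ∀ k ∈ 𝒦.K, ∀ a ∈ V, ∃ a' ∈ V, ∀ f : FinSB (Fp L) (Fin (n' + n')),
      adelicMpCont.omega (Fp L) (Fin (n' + n')) (gramDA L e' dV hdV (tensorFrame L dW eW dV') (tensorFrame_real L dW hdW eW dV' hdV'))
          (sB (UnitaryGroup.archToAdelic (Fp L) L (IsCMField.complexConj L) (n' + n')
            (hermD L e' dV hdV (tensorFrame L dW eW dV') (tensorFrame_real L dW hdW eW dV' hdV'))
            (UnitaryGroup.archPart (Fp L) L (IsCMField.complexConj L) (n' + n')
              (hermD L e' dV hdV (tensorFrame L dW eW dV') (tensorFrame_real L dW hdW eW dV' hdV'))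
              (tensorEmb L e dV hdV dW hdW eW e' dV' hdV' k))))
          (piSchwartzBruhatEquiv (Fp L) (Fin (n' + n')) (a ⊗ₜ[ℂ] f)) =
        piSchwartzBruhatEquiv (Fp L) (Fin (n' + n')) (a' ⊗ₜ[ℂ] f))
    {Φ : piSchwartzBruhat (Fp L) (Fin (n' + n'))}
    (hΦ : Φ ∈ Submodule.span ℂ {x : piSchwartzBruhat (Fp L) (Fin (n' + n')) |
      ∃ a ∈ V, ∃ f : FinSB (Fp L) (Fin (n' + n')), x = piSchwartzBruhatEquiv (Fp L) (Fin (n' + n')) (a ⊗ₜ[ℂ] f)}) :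
    FiniteDimensional ℂ (Submodule.span ℂ (Set.range fun k : 𝒦.K =>
      adelicMpCont.omega (Fp L) (Fin (n' + n')) (gramDA L e' dV hdV (tensorFrame L dW eW dV') (tensorFrame_real L dW hdW eW dV' hdV'))
        (sB (tensorEmb L e dV hdV dW hdW eW e' dV' hdV' (k : HA L e dV hdV dW hdW))) Φ)) := by
  -- notation-free abbreviations (local `let`s, no definitions)
  let ω := adelicMpCont.omega (Fp L) (Fin (n' + n')) (gramDA L e' dV hdV (tensorFrame L dW eW dV') (tensorFrame_real L dW hdW eW dV' hdV'))
  let O : piSchwartzBruhat (Fp L) (Fin (n' + n')) → Submodule ℂ (piSchwartzBruhat (Fp L) (Fin (n' + n'))) := fun Ψ =>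
    Submodule.span ℂ (Set.range fun k : 𝒦.K => ω (sB (tensorEmb L e dV hdV dW hdW eW e' dV' hdV' (k : HA L e dV hdV dW hdW))) Ψ)
  change FiniteDimensional ℂ (O Φ)
  induction hΦ using Submodule.span_induction with
  | zero =>
    refine Submodule.finiteDimensional_of_le (S₂ := ⊥) (Submodule.span_le.2 ?_)
    rintro _ ⟨k, rfl⟩
    simp only [map_zero, SetLike.mem_coe, Submodule.mem_bot]
  | add x y _ _ hx hy =>
    haveI := hx
    haveI := hy
    refine Submodule.finiteDimensional_of_le (S₂ := O x ⊔ O y) (Submodule.span_le.2 ?_)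
    rintro _ ⟨k, rfl⟩
    simp only [map_add, SetLike.mem_coe]
    exact Submodule.add_mem_sup (Submodule.subset_span ⟨k, rfl⟩) (Submodule.subset_span ⟨k, rfl⟩)
  | smul c x _ hx =>
    haveI := hx
    refine Submodule.finiteDimensional_of_le (S₂ := O x) (Submodule.span_le.2 ?_)
    rintro _ ⟨k, rfl⟩
    simp only [map_smul, SetLike.mem_coe]
    exact Submodule.smul_mem _ c (Submodule.subset_span ⟨k, rfl⟩)
  | mem x hx =>
    obtain ⟨a, ha, f, rfl⟩ := hx
    -- the finite set of finite-part translates of `f` and its span `F`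
    let ψ : 𝒦.K → FinSB (Fp L) (Fin (n' + n')) := fun k =>
      finRepMp (DoubledWeilUniqueness.isUnit_gramDA L e' dV hdV hdV0 (tensorFrame L dW eW dV') (tensorFrame_real L dW hdW eW dV' hdV')
          (tensorFrame_ne_zero L dW eW dV' hdW0 hdV'0))
        (sB.comp (UnitaryGroup.finAdelicToAdelic (Fp L) L (IsCMField.complexConj L) (n' + n')
          (hermD L e' dV hdV (tensorFrame L dW eW dV') (tensorFrame_real L dW hdW eW dV' hdV'))))
        (proj_sD_finAdelicToAdelic_apply_archVec L e' dV hdV hdV0 (tensorFrame L dW eW dV') (tensorFrame_real L dW hdW eW dV' hdV')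
          (tensorFrame_ne_zero L dW eW dV' hdW0 hdV'0) hsB)
        (UnitaryGroup.finPart (Fp L) L (IsCMField.complexConj L) (n' + n')
          (hermD L e' dV hdV (tensorFrame L dW eW dV') (tensorFrame_real L dW hdW eW dV' hdV'))
          (tensorEmb L e dV hdV dW hdW eW e' dV' hdV' (k : HA L e dV hdV dW hdW))) f
    have hψ : (Set.range ψ).Finite :=
      finite_range_finRepMp_finPart_tensorEmb L e dV hdV hdV0 dW hdW hdW0 eW e' dV' hdV' hdV'0 𝒦 hsB f
    let F : Submodule ℂ (FinSB (Fp L) (Fin (n' + n'))) := Submodule.span ℂ (Set.range ψ)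
    haveI : FiniteDimensional ℂ F := FiniteDimensional.span_of_finite ℂ hψ
    -- the finite-dimensional target `E(V ⊗ F)`
    let T : V ⊗[ℂ] F →ₗ[ℂ] piSchwartzBruhat (Fp L) (Fin (n' + n')) :=
      (piSchwartzBruhatEquiv (Fp L) (Fin (n' + n'))).toLinearMap ∘ₗ TensorProduct.map V.subtype F.subtype
    refine Submodule.finiteDimensional_of_le (S₂ := LinearMap.range T) (Submodule.span_le.2 ?_)
    rintro _ ⟨k, rfl⟩
    -- `ω(s^B g) E(a ⊗ f) = ω(s^B(g_∞,1)) E(a ⊗ ω^B_f(g_f) f) = E(a′ ⊗ ψ k)`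
    obtain ⟨a', ha', hVa⟩ := hV k k.2 a ha
    have key : ω (sB (tensorEmb L e dV hdV dW hdW eW e' dV' hdV' (k : HA L e dV hdV dW hdW)))
        (piSchwartzBruhatEquiv (Fp L) (Fin (n' + n')) (a ⊗ₜ[ℂ] f)) =
        piSchwartzBruhatEquiv (Fp L) (Fin (n' + n')) (a' ⊗ₜ[ℂ] ψ k) :=
      (omega_sD_tmul_eq L e' dV hdV hdV0 (tensorFrame L dW eW dV') (tensorFrame_real L dW hdW eW dV' hdV')
        (tensorFrame_ne_zero L dW eW dV' hdW0 hdV'0) hsB _ a f).trans (hVa _)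
    have hT : T (⟨a', ha'⟩ ⊗ₜ[ℂ] ⟨ψ k, Submodule.subset_span ⟨k, rfl⟩⟩) =
        piSchwartzBruhatEquiv (Fp L) (Fin (n' + n')) (a' ⊗ₜ[ℂ] ψ k) := by
      show piSchwartzBruhatEquiv (Fp L) (Fin (n' + n')) (TensorProduct.map V.subtype F.subtype (_ ⊗ₜ[ℂ] _)) = _
      rw [TensorProduct.map_tmul]
      rfl
    exact LinearMap.mem_range.2 ⟨_, hT.trans key.symm⟩

end Summit.HodgeConjecture.HodgeConjecture.Cruxes.HLiu418.K2LiuRigidityDomainKFinite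

end
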